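import Summits.BirchSwinnertonDyer.BirchSwinnertonDyer.Theorems.ErratumRoadFiveBstwDoorBdpFrameValue
import Summits.BirchSwinnertonDyer.BirchSwinnertonDyer.Theorems.ErratumRoadFiveBdvCalibrationSplitRDefs
import Summits.BirchSwinnertonDyer.BirchSwinnertonDyer.Theorems.ManinLocalTwoThreeLineIndexFinite
import Literature.NumberTheory.EllipticCurves.MordellWeilTheoremProofs
import HarnessLib

/-!
# The BSTW door for `KatoValuationIneqNonsplitAtFive` — A: the crossing identity at an ABSTRACT exponent, and its instance
# on the AMENDED exponent R (crux stmt-BirchSwinnertonDyer-19715, (α2) item stmt-BirchSwinnertonDyer-33169)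

LEAD `bsd-line-er5-p1` g20 (pen word `d2R` P1, 2026-08-31T03:03:23Z).  Hosted from idea-9's door
`Cruxes/KatoValuationIneqNonsplitAtFive/Lines/bstw_door.lean` (registry r2 a6e65636170da625): the glue
`bstwCrossing_of_normIdentity` (l.1016–1098) — A♯ (`ErratumRoadFiveBstwDoor.bdpFrameValue`) and a NORM IDENTITY of A♭'s shape
at an ABSTRACT exponent `v` give `∃ e`, `r_f ≠ 0` and `v + 1 + ord_p c + ord_p s + ord_p k + (ord_p r_f − ord_p m_f) =
2·ord_p log_ω e(P_L)` — proof VERBATIM (S0′'s conjuncts as named-fact hypotheses; `r_f ≠ 0` by the tree's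
`ManinLocalTwoThree.congruenceNumber_ne_zero_of_datum`, Pasten–Shimura); and its instance ON THE AMENDED EXPONENT:
`bstwCrossingNonsplitFamilyR` = the door's `bstwCrossingNonsplitFamily` (l.1100–1161) with A♭-fam replaced by the HYPOTHESIS
`AFlatFamStatementR` (`ErratumRoadFiveBdvCalibrationSplitRDefs`, exponent `… − v_p φ(N) − v(σ)`), fed to the abstract glue at
`v′ := v(σ) + v_p(λ/(q·R·∏P_ℓ)) + v_p φ(N)` (`a − ν − v = a − (v + ν)`, one `ring`): the conclusion carries `+ v_p φ(N)` on the
left.  This is the kernel form of the C-sign check: the index `ν = v_p φ(N) ≥ 0` sits on the side of `ord_p t`, so the ν-free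
valuation inequality follows with slack `ν` (`ErratumRoadFiveBstwDoorValuationIneqR`).
No registered stub, no crux and no summit statement is proved here: A♭-famR is OPEN (a hypothesis); typed ≠ proved; BSD is
proved for no curve.
-/

set_option autoImplicit false
-- D-0017: single-problem summit, so `Summit.BirchSwinnertonDyer.BirchSwinnertonDyer.…` repeats a namespace BY DESIGN.
set_option linter.dupNamespace false

noncomputable section

open scoped Classical NumberField TensorProduct BigOperators

namespace Summit.BirchSwinnertonDyer.BirchSwinnertonDyer.Theorems.ErratumRoadFiveBstwDoor

open Field
open Literature.NumberTheory.GaloisRepresentations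
open Literature.NumberTheory.EllipticCurves Literature.NumberTheory.EllipticCurves.Kato2004
open Literature.NumberTheory.EllipticCurves.Kato2004.EulerSystemValues
open Literature.NumberTheory.EllipticCurves.Rank1Residual
open Literature.NumberTheory.EllipticCurves.Rank1Residual.Typed
open Literature.NumberTheory.EllipticCurves.ModularForms
open Literature.NumberTheory.EllipticCurves.Castella2018
open Summit.BirchSwinnertonDyer.Rank1Residual
open Summit.BirchSwinnertonDyer.BirchSwinnertonDyer.Theorems
open Summit.BirchSwinnertonDyer.BirchSwinnertonDyer.Theorems.ErratumRoadFiveBdvCalibrationSplit (bottomClass)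
open Summit.BirchSwinnertonDyer.BirchSwinnertonDyer.Theorems.ErratumRoadFiveBdvCalibrationSplitR (AFlatFamStatementR)
open IsDedekindDomain (HeightOneSpectrum)
open CongruenceSubgroup (Gamma0)

/-! ## §1 A — the crossing identity from A♯ and a norm identity of A♭'s shape, at an ABSTRACT exponent (door l.1016–1098) -/

/-- **A — the crossing identity from A♯ and a NORM IDENTITY of A♭'s shape, at an ABSTRACT exponent `v`** (door
`bstwCrossing_of_normIdentity`, verbatim; the embedding `e : L → ℚ_p` is the one A♯'s frame reads its logarithm through).  From A♯
(`bdpFrameValue`: a frame with `L_𝔭(f)(𝟙) = u·((1 − a_p p⁻¹)·log_ω e(P_L)/c)²`) and `hflat` (`‖X‖ = p^{1 + ord_p c − ord_p s − ord_p k −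
(ord_p r_f − ord_p m_f) − v}` for every frame and value): `∃ e`, `r_f ≠ 0` (Pasten–Shimura) with `v + 1 + ord_p c + ord_p s + ord_p k +
(ord_p r_f − ord_p m_f) = 2·ord_p log_ω e(P_L)`; `ord_p(1 − a_p/p) = −1` (`a_p = ±1`, Kraus–Oesterlé).  For `P_L` of INFINITE ORDER.
[cite: BurungaleSkinnerTianWan2024, §6.2.1 (arXiv:2409.01350 pp. 59–60)] [cite: Castella2018, Thm. 3.2 (arXiv:1704.06608 p. 9)]
[cite: PastenShimura2024, §5.4–5.6 (pp. 17–19)] -/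
theorem bstwCrossing_of_normIdentity (h32 : thm32_exists_isBDPLFunction_valueAtOne)
    (hVC : castella2018Exceptional_bdpValueContinuity_trivialChar)
    (hH14 : hsieh2014_exists_anticyclotomicPAdicLFunction_unrPeriod)
    (hBDP13 : bertoliniDarmonPrasanna2013_centralValue_reciprocity)
    {W : WeierstrassCurve ℚ} [W.IsElliptic] [W.IsGloballyMinimal] {p : ℕ} [Fact p.Prime]
    [NeZero (W.conductorNorm ℤ)]
    (hX : ClassX11b W p) (h5 : 5 ≤ p) (hS : Surj W p)
    {L : Type} [Field L] [NumberField L] (hLq : IsImaginaryQuadratic L)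
    (hH : SatisfiesHeegnerHypothesis (W.conductorNorm ℤ) L) (hHp : SatisfiesHeegnerHypothesis p L)
    (hd4 : NumberField.discr L < -4) (hodd : Odd (NumberField.discr L))
    (Dt : ModularParametrizationData W (W.conductorNorm ℤ))
    (Hd : HeegnerDatum (W.conductorNorm ℤ) (NumberField.discr L)) (w₀ : NumberField.InfinitePlace L)
    (PL : (W.baseChange L).toAffine.Point)
    (hPL : WeierstrassCurve.Affine.Point.map w₀.embedding.toRatAlgHom PL = heegnerPointComplex Dt Hd)
    (hc : ¬ (p : ℤ) ∣ Dt.c) (hinf : ¬ IsOfFinAddOrder PL) (s : ℚ) (k : ℤ)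
    {W' : WeierstrassCurve ℚ} [W'.IsElliptic] (D : ModularParametrizationData W' (W.conductorNorm ℤ)) (v : ℤ)
    (hflat : ∀ (ι' : PadicAlgCl p ≃+* ℂ)
        (κ : ZpExtension L p) (γ' : absoluteGaloisGroup L) (ΩK : ℂ) (Ωp : (unrIntegers p)ˣ) (Λf : UnrSeries p),
        κ.IsAnticyclotomic → κ.IsTopGenerator γ' → ΩK ≠ 0 →
        IsBDPLFunction ι' (X11b.primeOfEmbeddingDatum p ι' w₀.embedding) κ γ' Dt.f ΩK
          ((Ωp : unrIntegers p) : ℂ_[p]) Λf →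
      ∀ (X : ℂ_[p]), Λf.HasValueAt 0 X →
        ‖X‖ = (p : ℝ) ^ (1 + padicValInt p Dt.c - padicValRat p s - padicValInt p k -
            ((padicValNat p (congruenceNumber Dt.f) : ℤ) - padicValNat p D.modularDegree) - v)) :
    ∃ e : L →+* ℚ_[p], congruenceNumber Dt.f ≠ 0 ∧
      v + 1 + padicValInt p Dt.c + padicValRat p s + padicValInt p k +
          ((padicValNat p (congruenceNumber Dt.f) : ℤ) - padicValNat p D.modularDegree) =
        2 * (padicLogOmega W p e PL).valuation := by
  -- A♯: a BDP frame of `(f, L, p)` with its Waldspurger value at `𝟙`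
  obtain ⟨ι', e, κ, γ', ΩK, Ωp, Λf, he, hκ, hγ', hΩK, hBDP, u, hval⟩ :=
    bdpFrameValue h32 hVC hH14 hBDP13 W p hX h5 hS L hLq hH hHp hd4 hodd Dt Hd w₀ PL hPL hc hinf
  -- the norm identity at that frame and that value
  have hnorm := hflat ι' κ γ' ΩK Ωp Λf hκ hγ' hΩK hBDP _ hval
  refine ⟨e, ManinLocalTwoThree.congruenceNumber_ne_zero_of_datum Dt, ?_⟩
  -- names
  set y : ℚ_[p] := ((1 : ℚ_[p]) - (W.LFunction p : ℚ_[p]) * (p : ℚ_[p])⁻¹) * padicLogOmega W p e PL /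
    (Dt.c : ℚ_[p]) with hy
  set m : ℤ := 1 + padicValInt p Dt.c - padicValRat p s - padicValInt p k -
    ((padicValNat p (congruenceNumber Dt.f) : ℤ) - padicValNat p D.modularDegree) - v with hm
  have hp1 : (1 : ℝ) < p := by exact_mod_cast (Fact.out : p.Prime).one_lt
  have hp0 : (0 : ℝ) < p := by positivity
  -- `‖X‖ = ‖y‖²`
  have hXy : ‖(((u : unrIntegers p) : ℂ_[p]) * (algebraMap ℚ_[p] ℂ_[p] y) ^ 2)‖ = ‖y‖ ^ 2 := by
    rw [norm_mul, X11b.Halves.norm_coe_units_unrIntegers, one_mul, norm_pow, norm_algebraMap']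
  rw [hXy] at hnorm
  -- hence `y ≠ 0`, so `log_ω e(P_L) ≠ 0` and `c ≠ 0` in `ℚ_p`
  have hy0 : y ≠ 0 := by
    intro h0
    rw [h0, norm_zero, zero_pow two_ne_zero] at hnorm
    exact (zpow_pos hp0 m).ne' hnorm.symm
  have hfac0 : ((1 : ℚ_[p]) - (W.LFunction p : ℚ_[p]) * (p : ℚ_[p])⁻¹) * padicLogOmega W p e PL ≠ 0 := by
    intro h0; exact hy0 (by rw [hy, h0, zero_div])
  have hc0 : (Dt.c : ℚ_[p]) ≠ 0 := by
    intro h0; exact hy0 (by rw [hy, h0, div_zero])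
  have hlog0 : padicLogOmega W p e PL ≠ 0 := fun h0 ↦ hfac0 (by rw [h0, mul_zero])
  have heul0 : (1 : ℚ_[p]) - (W.LFunction p : ℚ_[p]) * (p : ℚ_[p])⁻¹ ≠ 0 := fun h0 ↦ hfac0 (by rw [h0, zero_mul])
  -- `a_p = ±1` at the multiplicative prime `p`, so `ord_p (1 − a_p p⁻¹) = −1`
  have ha : W.LFunction p = 1 ∨ W.LFunction p = -1 :=
    KrausOesterle1992.lFunction_apply_prime_eq_one_or_eq_neg_one_of_mult W p hX.2.2.1
  have heul : ((1 : ℚ_[p]) - (W.LFunction p : ℚ_[p]) * (p : ℚ_[p])⁻¹).valuation = -1 := by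
    have hn := X11b.Halves.norm_one_sub_div_eq p ha
    rw [Padic.norm_eq_zpow_neg_valuation heul0] at hn
    have : (p : ℝ) ^ (-((1 : ℚ_[p]) - (W.LFunction p : ℚ_[p]) * (p : ℚ_[p])⁻¹).valuation) = (p : ℝ) ^ (1 : ℤ) := by
      rw [hn, zpow_one]
    have hinj := zpow_right_injective₀ hp0 hp1.ne' this
    omega
  -- `ord_p y = −1 + ord_p log − ord_p c`
  have hyval : y.valuation = -1 + (padicLogOmega W p e PL).valuation - padicValInt p Dt.c := by
    rw [hy, div_eq_mul_inv, Padic.valuation_mul (mul_ne_zero heul0 hlog0) (inv_ne_zero hc0),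
      Padic.valuation_mul heul0 hlog0, heul, Padic.valuation_inv, Padic.valuation_intCast]
    ring
  -- compare the two expressions for `‖X‖`
  rw [Padic.norm_eq_zpow_neg_valuation hy0, ← zpow_natCast, ← zpow_mul] at hnorm
  have hexp := zpow_right_injective₀ hp0 hp1.ne' hnorm
  push_cast at hexp
  rw [hyval] at hexp
  omega

/-! ## §2 A at the FAMILY exponent ON R (door l.1100–1161 with A♭-fam ↦ the hypothesis `AFlatFamStatementR`) -/

/-- **A at the FAMILY exponent on the AMENDED exponent R** (door `bstwCrossingNonsplitFamily`, A♭-fam replaced by the OPEN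
hypothesis `AFlatFamStatementR`): for every value-pinned Kato family with Λ-adic lift `y` and period ratio `λ`, every Kummer
logarithm `σ ≠ 0` of `proj₀ y`, and `P_L` of infinite order: `∃ e`, `r_f ≠ 0` with `v(σ) + v_p(λ/(q·R⁻_𝟙·∏P_ℓ)) + v_p φ(N) + 1 +
ord_p c + ord_p s + ord_p k + (ord_p r_f − ord_p m_f) = 2·ord_p log_ω e(P_L)` — the abstract glue at `v′ = v(σ) + v_p(λ/…) + v_p φ(N)`.
[cite: BurungaleSkinnerTianWan2024, §6.2.1 (arXiv:2409.01350 pp. 59–60)] [cite: Kato2004Asterisque, Thm. 12.5 (1) (pp. 221–222)]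
[cite: KingsLoefflerZerbes2017, Thm. 2.7.4] -/
theorem bstwCrossingNonsplitFamilyR (h32 : thm32_exists_isBDPLFunction_valueAtOne)
    (hVC : castella2018Exceptional_bdpValueContinuity_trivialChar)
    (hH14 : hsieh2014_exists_anticyclotomicPAdicLFunction_unrPeriod)
    (hBDP13 : bertoliniDarmonPrasanna2013_centralValue_reciprocity) (hA : AFlatFamStatementR) :
    ∀ (W : WeierstrassCurve ℚ) [W.IsElliptic] [W.IsGloballyMinimal] (p : ℕ) [Fact p.Prime]
      [ContinuousSMul ℤ_[p] (W.tateModule p)] [Module.Free ℤ_[p] (W.tateModule p)]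
      [Module.Finite ℤ_[p] (W.tateModule p)] [NeZero (W.conductorNorm ℤ)],
      ClassX11b W p → 5 ≤ p → Surj W p → ¬ W.HasSplitMultiplicativeReductionAtPrime p →
      ∀ (L : Type) [Field L] [NumberField L], IsImaginaryQuadratic L →
        SatisfiesHeegnerHypothesis (W.conductorNorm ℤ) L → SatisfiesHeegnerHypothesis p L →
        NumberField.discr L < -4 → Odd (NumberField.discr L) →
        (W.quadraticTwist (NumberField.discr L : ℚ)).entireLFunction 1 ≠ 0 →
      ∀ (Dt : ModularParametrizationData W (W.conductorNorm ℤ))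
        (Hd : HeegnerDatum (W.conductorNorm ℤ) (NumberField.discr L)) (w₀ : NumberField.InfinitePlace L)
        (PL : (W.baseChange L).toAffine.Point),
        WeierstrassCurve.Affine.Point.map w₀.embedding.toRatAlgHom PL = heegnerPointComplex Dt Hd →
        ¬ (p : ℤ) ∣ Dt.c → ¬ IsOfFinAddOrder PL →
      ∀ (s : ℚ) (k : ℤ),
        (Real.sqrt ((NumberField.discr L).natAbs : ℝ) : ℂ) *
            (W.quadraticTwist (NumberField.discr L : ℚ)).entireLFunction 1 = (s : ℂ) * (minusPeriod Dt.f : ℂ) →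
        (Dt.c : ℝ) * minusPeriod Dt.f = k * W.imaginaryPeriodRat →
      ∀ (W' : WeierstrassCurve ℚ) [W'.IsElliptic] (D : ModularParametrizationData W' (W.conductorNorm ℤ)),
        D.f = Dt.f →
        (∀ (W'' : WeierstrassCurve ℚ) [W''.IsElliptic] (D'' : ModularParametrizationData W'' (W.conductorNorm ℤ)),
            D''.f = D.f → D.modularDegree ≤ D''.modularDegree) →
      ∀ (K : ZpExtension ℚ p) (hK : K.IsCyclotomic) (γ : absoluteGaloisGroup ℚ)
        (I : IwasawaH1Data W p K γ), K.IsTopGenerator γ →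
      ∀ (hp : p ≠ 2) (N : ℕ) [NeZero N] (f : CuspForm (Gamma0 N) 2), IsNewformOf W f →
      ∀ (ι : (n : ℕ) → (CyclotomicField n ℚ →+* ℂ)) (q : ℚ)
        (Λ : ∀ (m : ℕ) (r : Finset (HeightOneSpectrum (𝓞 ℚ))),
          H1 (tateRep W p) (cycSubgroup p m r) →ₗ[ℤ_[p]] ℚ_[p] ⊗[ℚ] CyclotomicField (cycLevel p m r) ℚ)
        (c d₁ a : ℤ) (A : ℕ) (d' : ℤ)
        (z : ∀ (m : ℕ) (r : (cyclotomicLevelsRat p (badPlaces c d₁ A N)).Ideals),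
          H1 (tateRep W p) ((cyclotomicLevelsRat p (badPlaces c d₁ A N)).level m r.1))
        (x : ∀ (m : ℕ) (r : (cyclotomicLevelsRat p (badPlaces c d₁ A N)).Ideals),
          CyclotomicField (cycLevel p m r.1) ℚ)
        (y : I.H) (perRatio : ℚ),
        q ≠ 0 → ZetaBody W p f ι ((q : ℚ) : ℝ) Λ c d₁ a A z x →
        (∀ n : ℕ, I.proj n y =
          levelToLayer W p hK hp (badPlaces c d₁ A N) n
            (z (n + 1) (cyclotomicLevelsRat p (badPlaces c d₁ A N)).idealOne)) →
        0 < A → Int.gcd c (6 * p * A) = 1 → Int.gcd d₁ (6 * p * N) = 1 → (d₁ : ℤ) * d' ≡ 1 [ZMOD (A : ℤ)] →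
        ratCuspFactor f true c d₁ a A d' ≠ 0 → perRatio ≠ 0 →
        plusPeriod f = ((perRatio : ℚ) : ℝ) * W.realPeriodRat →
      ∀ σ : ℚ_[p], HasLocPKummerLog W p (bottomClass W p K I y) σ → σ ≠ 0 →
      ∃ e : L →+* ℚ_[p], congruenceNumber Dt.f ≠ 0 ∧
        σ.valuation + padicValRat p (perRatio /
              (q * ratCuspFactor f true c d₁ a A d' * ∏ ℓ ∈ A.primeFactors.erase p, eulerFactorAtOne W N ℓ)) +
            (padicValNat p (Nat.totient N) : ℤ) +
            1 + padicValInt p Dt.c + padicValRat p s + padicValInt p k +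
            ((padicValNat p (congruenceNumber Dt.f) : ℤ) - padicValNat p D.modularDegree) =
          2 * (padicLogOmega W p e PL).valuation := by
  intro W _ _ p _ _ _ _ _ hX h5 hS hns L _ _ hLq hH hHp hd4 hodd hLt Dt Hd w₀ PL hPL hc hinf s k hs hk W' _ D hDf hmin
    K hK γ I hγ hp N _ f hf ι q Λ c d₁ a A d' z x y perRatio hq hzeta hy hA0 hcg hd hdd' hR hper0 hper σ hσ hσ0
  exact bstwCrossing_of_normIdentity h32 hVC hH14 hBDP13 hX h5 hS hLq hH hHp hd4 hodd Dt Hd w₀ PL hPL hc hinf s k D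
    (σ.valuation + padicValRat p (perRatio /
      (q * ratCuspFactor f true c d₁ a A d' * ∏ ℓ ∈ A.primeFactors.erase p, eulerFactorAtOne W N ℓ)) +
      (padicValNat p (Nat.totient N) : ℤ))
    (fun ι' κ γ' ΩK Ωp Λf hκ hγ' hΩK hBDP X hXv => by
      have hflatR := hA W p hX h5 hS hns L hLq hH hHp hd4 hodd hLt Dt Hd w₀ PL hPL hc s k hs hk
        W' D hDf hmin K hK γ I hγ hp N f hf ι q Λ c d₁ a A d' z x y perRatio hq hzeta hy hA0 hcg hd hdd' hR hper0 hper
        ι' κ γ' ΩK Ωp Λf hκ hγ' hΩK hBDP X hXv σ hσ hσ0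
      rw [hflatR]
      congr 1
      ring)

/-! ## §3 Sorry-free helpers of the door's cores (door l.1226–1259, verbatim — `padicValNat_le_of_dvd` is the tree's `AddKatoTwo.padicValNat_le_of_dvd'`, inlined downstream; consumed by `ErratumRoadFiveBstwDoorValuationIneqR`) -/

/-- A modular parametrisation datum of MINIMAL degree among those with a given newform exists (well-ordering of
`ℕ`, witnessed by `Dt` itself). [folklore] -/
theorem exists_minimal_datum {W : WeierstrassCurve ℚ} [W.IsElliptic] {N : ℕ} [NeZero N]
    (Dt : ModularParametrizationData W N) :
    ∃ (W' : WeierstrassCurve ℚ) (_ : W'.IsElliptic) (D : ModularParametrizationData W' N), D.f = Dt.f ∧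
      ∀ (W'' : WeierstrassCurve ℚ) [W''.IsElliptic] (D'' : ModularParametrizationData W'' N),
        D''.f = D.f → D.modularDegree ≤ D''.modularDegree := by
  classical
  let S : Set ℕ := {m | ∃ (W' : WeierstrassCurve ℚ) (_ : W'.IsElliptic) (D : ModularParametrizationData W' N),
    D.f = Dt.f ∧ D.modularDegree = m}
  have hS : ∃ m, m ∈ S := ⟨Dt.modularDegree, W, ‹_›, Dt, rfl, rfl⟩
  obtain ⟨W', hW', D, hDf, hDm⟩ := Nat.find_spec hS
  refine ⟨W', hW', D, hDf, fun W'' _ D'' hD'' => ?_⟩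
  rw [hDm]
  exact Nat.find_min' hS ⟨W'', ‹_›, D'', hD''.trans hDf, rfl⟩

/-- A member of a Mordell–Weil basis has infinite order (any field: its class in `E(K)/E(K)_{tors}` belongs to a
`ℤ`-linearly independent family, hence is non-zero).  Stated for the group law of `IsMordellWeilBasis` (classical
decidable equality on `K`). [folklore] -/
theorem not_isOfFinAddOrder_of_isMordellWeilBasis {K : Type*} [Field K] {W : WeierstrassCurve K} {ι : Type*}
    {P : ι → W.toAffine.Point} (hP : W.IsMordellWeilBasis P) (i : ι) : ¬ IsOfFinAddOrder (P i) := by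
  intro htor
  apply hP.1.ne_zero i
  simp only [Function.comp_apply]
  exact (QuotientAddGroup.eq_zero_iff _).mpr htor

/-- The same over `ℚ` for the group law elaborated with `instDecidableEqRat` (the two `DecidableEq ℚ` instances agree —
`Subsingleton.elim`, transported by `convert`; pattern of the tree's `IsMordellWeilBasis.not_isOfFinAddOrder_rat`). [folklore] -/
theorem not_isOfFinAddOrder_of_isMordellWeilBasis_rat {W : WeierstrassCurve ℚ} {ι : Type*}
    {P : ι → W.toAffine.Point} (hP : W.IsMordellWeilBasis P) (i : ι) : ¬ IsOfFinAddOrder (P i) := by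
  convert not_isOfFinAddOrder_of_isMordellWeilBasis hP i

end Summit.BirchSwinnertonDyer.BirchSwinnertonDyer.Theorems.ErratumRoadFiveBstwDoor

end
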